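import Summits.CriticalPhenomena.PercolationContinuityZ3.Theorems.PercGamblersRuinVerticalGamblersRuinDeterministicTime

/-!
# Route `PercGamblersRuin`, crux `VerticalGamblersRuin` (stmt-CriticalPhenomena-10642):
# linearity and locality of the SRW averaging operator (line `registered`, rev 9, lead c3)

Helper file for the Paley–Zygmund step `DIFF ⇒ AC` of the line `registered`
(`Theorems/PercGamblersRuinVerticalGamblersRuinDiffusivity.lean`).  For the UNKILLED one-step averaging
operator `𝒫_ω g x := (∑ y ∈ N_ω(x), g y)/#N_ω(x)` of the simple random walk on the open cluster (pinned by
its formula; `Nat.iterate` for `𝒫^T`): monotonicity, positivity, homogeneity and additivity of `𝒫^T`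
(generic `N : V → Finset V`), the LOCALITY `(𝒫_ω^T F)(x) = (𝒫_ω^T G)(x)` when `F = G` on the sites of
height within `T` of `x₀` (the walk changes the height by at most one per step) — registered as
`stub_iterateLocality` — and the bound `0 ≤ (𝒫^T F)(x) ≤ B` for `0 ≤ F ≤ B` on those sites.
[folklore; Lyons–Peres 2016 §2.1]
-/

noncomputable section

namespace Summit.CriticalPhenomena.PercolationContinuityZ3.Theorems.VerticalGamblersRuin

open MeasureTheory Filter Topology
open Literature.Probability.Percolation Literature.Probability.LatticeModels
open scoped Classical

namespace Diffusivity

section Kernel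

/-! ### The unkilled averaging operator: order and linearity -/

variable {V : Type*} {N : V → Finset V} {Ψ : (V → ℝ) → V → ℝ}

/-- The unkilled averaging operator is monotone. [folklore] -/
theorem full_mono (hΨ : ∀ f x, Ψ f x = (∑ y ∈ N x, f y) / ((N x).card : ℝ))
    {f g : V → ℝ} (hfg : ∀ x, f x ≤ g x) (x : V) : Ψ f x ≤ Ψ g x := by
  rw [hΨ, hΨ]
  exact div_le_div_of_nonneg_right (Finset.sum_le_sum fun y _ => hfg y) (Nat.cast_nonneg _)

/-- Iterates of the unkilled operator are monotone. [folklore] -/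
theorem full_iterate_mono (hΨ : ∀ f x, Ψ f x = (∑ y ∈ N x, f y) / ((N x).card : ℝ)) (T : ℕ) :
    ∀ {f g : V → ℝ}, (∀ x, f x ≤ g x) → ∀ x, (Ψ^[T] f) x ≤ (Ψ^[T] g) x := by
  induction T with
  | zero => intro f g hfg x; simpa using hfg x
  | succ T ih =>
    intro f g hfg x
    rw [Function.iterate_succ_apply, Function.iterate_succ_apply]
    exact ih (fun y => full_mono hΨ hfg y) x

/-- The unkilled operator kills the zero function. [folklore] -/
theorem full_iterate_zero (hΨ : ∀ f x, Ψ f x = (∑ y ∈ N x, f y) / ((N x).card : ℝ)) (T : ℕ) :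
    (Ψ^[T] fun _ => (0 : ℝ)) = fun _ => 0 := by
  induction T with
  | zero => rfl
  | succ T ih =>
    rw [Function.iterate_succ_apply]
    have : (Ψ fun _ => (0 : ℝ)) = fun _ => 0 := by
      funext x; rw [hΨ]; simp
    rw [this, ih]

/-- Iterates of the unkilled operator preserve nonnegativity. [folklore] -/
theorem full_iterate_nonneg (hΨ : ∀ f x, Ψ f x = (∑ y ∈ N x, f y) / ((N x).card : ℝ)) (T : ℕ)
    {f : V → ℝ} (hf : ∀ x, 0 ≤ f x) (x : V) : 0 ≤ (Ψ^[T] f) x := by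
  have h := full_iterate_mono hΨ T (f := fun _ => (0 : ℝ)) (g := f) hf x
  rwa [full_iterate_zero hΨ T] at h

/-- The unkilled operator commutes with scalars. [folklore] -/
theorem full_smul (hΨ : ∀ f x, Ψ f x = (∑ y ∈ N x, f y) / ((N x).card : ℝ)) (c : ℝ) (f : V → ℝ) :
    (Ψ fun y => c * f y) = fun x => c * Ψ f x := by
  funext x
  rw [hΨ, hΨ, ← Finset.mul_sum, mul_div_assoc]

/-- Iterates of the unkilled operator commute with scalars. [folklore] -/
theorem full_iterate_smul (hΨ : ∀ f x, Ψ f x = (∑ y ∈ N x, f y) / ((N x).card : ℝ)) (T : ℕ) :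
    ∀ (c : ℝ) (f : V → ℝ), (Ψ^[T] fun y => c * f y) = fun x => c * (Ψ^[T] f) x := by
  induction T with
  | zero => intro c f; rfl
  | succ T ih =>
    intro c f
    rw [Function.iterate_succ_apply, Function.iterate_succ_apply, full_smul hΨ, ih]

/-- The unkilled operator is additive. [folklore] -/
theorem full_add (hΨ : ∀ f x, Ψ f x = (∑ y ∈ N x, f y) / ((N x).card : ℝ)) (f g : V → ℝ) :
    (Ψ fun y => f y + g y) = fun x => Ψ f x + Ψ g x := by
  funext x
  rw [hΨ, hΨ, hΨ, Finset.sum_add_distrib, add_div]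

/-- Iterates of the unkilled operator are additive. [folklore] -/
theorem full_iterate_add (hΨ : ∀ f x, Ψ f x = (∑ y ∈ N x, f y) / ((N x).card : ℝ)) (T : ℕ) :
    ∀ f g : V → ℝ, (Ψ^[T] fun y => f y + g y) = fun x => (Ψ^[T] f) x + (Ψ^[T] g) x := by
  induction T with
  | zero => intro f g; rfl
  | succ T ih =>
    intro f g
    rw [Function.iterate_succ_apply, Function.iterate_succ_apply, Function.iterate_succ_apply,
      full_add hΨ, ih]

end Kernel

/-! ### Locality on the lattice -/

/-- **Locality of the iterates**: `(𝒫_ω^T F)(x)` only depends on `F` at sites of height within `T`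
of `x₀` (the walk moves the height by at most one per step). [folklore] -/
theorem full_iterate_congr_ball {Pop : BondConfig (Site 3) → (Site 3 → ℝ) → Site 3 → ℝ}
    (hPop : ∀ ω (g : Site 3 → ℝ) (x : Site 3), Pop ω g x =
      (∑ y ∈ ((zdGraph 3).neighborFinset x).filter (fun y => s(x, y) ∈ ω), g y) /
        ((((zdGraph 3).neighborFinset x).filter (fun y => s(x, y) ∈ ω)).card : ℝ))
    (ω : BondConfig (Site 3)) (T : ℕ) :
    ∀ (x : Site 3) (F G : Site 3 → ℝ), (∀ y : Site 3, |y 0 - x 0| ≤ (T : ℤ) → F y = G y) →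
      ((Pop ω)^[T] F) x = ((Pop ω)^[T] G) x := by
  induction T with
  | zero =>
    intro x F G h
    simpa using h x (by simp)
  | succ T ih =>
    intro x F G h
    rw [Function.iterate_succ_apply', Function.iterate_succ_apply', hPop, hPop]
    refine congrArg₂ (· / ·) (Finset.sum_congr rfl fun y hy => ?_) rfl
    rw [Finset.mem_filter, SimpleGraph.mem_neighborFinset] at hy
    refine ih y F G (fun z hz => h z ?_)
    have h1 : y 0 ≤ x 0 + 1 := SlabVoltage.apply_zero_le_of_adj hy.1
    have h2 : x 0 ≤ y 0 + 1 := SlabVoltage.apply_zero_le_of_adj hy.1.symm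
    rw [abs_le] at hz ⊢
    push_cast at hz ⊢
    constructor <;> linarith [hz.1, hz.2]

/-- **Bounds for the iterates of a function bounded on the accessible heights**: if `0 ≤ F` and
`F ≤ B` at every site of height within `T` of `x₀`, then `0 ≤ (𝒫^T F)(x) ≤ B`. [folklore] -/
theorem full_iterate_mem_Icc_of_ball {Pop : BondConfig (Site 3) → (Site 3 → ℝ) → Site 3 → ℝ}
    (hPop : ∀ ω (g : Site 3 → ℝ) (x : Site 3), Pop ω g x =
      (∑ y ∈ ((zdGraph 3).neighborFinset x).filter (fun y => s(x, y) ∈ ω), g y) /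
        ((((zdGraph 3).neighborFinset x).filter (fun y => s(x, y) ∈ ω)).card : ℝ))
    (ω : BondConfig (Site 3)) (T : ℕ) (x : Site 3) {F : Site 3 → ℝ} {B : ℝ} (hB : 0 ≤ B)
    (hF0 : ∀ y, 0 ≤ F y) (hFB : ∀ y : Site 3, |y 0 - x 0| ≤ (T : ℤ) → F y ≤ B) :
    0 ≤ ((Pop ω)^[T] F) x ∧ ((Pop ω)^[T] F) x ≤ B := by
  -- truncate `F` outside the ball, then compare with the constants `0` and `B`
  set G : Site 3 → ℝ := fun y => if |y 0 - x 0| ≤ (T : ℤ) then F y else 0 with hGdef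
  have hFG : ((Pop ω)^[T] F) x = ((Pop ω)^[T] G) x :=
    full_iterate_congr_ball hPop ω T x F G (fun y hy => by simp only [hGdef, if_pos hy])
  have hG : ∀ y, 0 ≤ G y ∧ G y ≤ B := fun y => by
    simp only [hGdef]
    split_ifs with hy
    · exact ⟨hF0 y, hFB y hy⟩
    · exact ⟨le_rfl, hB⟩
  rw [hFG]
  rcases eq_or_lt_of_le hB with hB0 | hBpos
  · -- `B = 0`: `G = 0`
    have hG0 : G = fun _ => 0 := funext fun y => le_antisymm (hB0 ▸ (hG y).2) (hG y).1
    rw [hG0, full_iterate_zero (hPop ω) T]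
    exact ⟨le_rfl, hB⟩
  · have h := DeterministicTime.full_iterate_mem_Icc (hPop ω) T (f := fun y => B⁻¹ * G y) (fun y =>
      ⟨mul_nonneg (inv_nonneg.2 hB) (hG y).1, by
        rw [inv_mul_le_iff₀ hBpos, mul_one]; exact (hG y).2⟩) x
    rw [full_iterate_smul (hPop ω) T] at h
    simp only at h
    constructor
    · have := h.1
      rwa [mul_nonneg_iff_of_pos_left (inv_pos.2 hBpos)] at this
    · have := h.2
      rwa [inv_mul_le_iff₀ hBpos, mul_one] at this

end Diffusivity

open Diffusivity in
/-- **stub `stub_iterateLocality`** of line `registered` (rev 9; exact registered signature): locality of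
the iterates of the SRW averaging operator — `(𝒫_ω^T F)(x)` only depends on `F` at heights within `T`
of `x₀`. -/
theorem stub_iterateLocality :
    ∀ (Pop : BondConfig (Site 3) → (Site 3 → ℝ) → Site 3 → ℝ),
      (∀ ω (g : Site 3 → ℝ) (x : Site 3), Pop ω g x =
        (∑ y ∈ ((zdGraph 3).neighborFinset x).filter (fun y => s(x, y) ∈ ω), g y) /
          ((((zdGraph 3).neighborFinset x).filter (fun y => s(x, y) ∈ ω)).card : ℝ)) →
      ∀ (ω : BondConfig (Site 3)) (T : ℕ) (x : Site 3) (F G : Site 3 → ℝ),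
        (∀ y : Site 3, |y 0 - x 0| ≤ (T : ℤ) → F y = G y) →
        ((Pop ω)^[T] F) x = ((Pop ω)^[T] G) x := by
  intro Pop hPop ω T x F G h
  exact full_iterate_congr_ball hPop ω T x F G h

end Summit.CriticalPhenomena.PercolationContinuityZ3.Theorems.VerticalGamblersRuin

end
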